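import Mathlib.Analysis.SpecialFunctions.SmoothTransition
import Mathlib.Analysis.Calculus.Deriv.Slope
import Literature.Topology.FourManifolds.BoundaryLocalMinDerivative
import Literature.Topology.FourManifolds.GradientLikeExistence
import Literature.Topology.FourManifolds.MorseAffine
import Literature.Topology.FourManifolds.HCobordismTradeStep
import Literature.Topology.FourManifolds.SPC4HandleChainProofs
import Literature.Topology.FourManifolds.HCobordismLevelConnectivity
import HarnessLib

/-!
# Wall 1964, Lemma 2, Morse-theoretic route: blending two Morse functions of a triad near the
# incoming end

Topic `Literature/Topology/FourManifolds` (fact seat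
`provefact-Literature.Topology.FourManifolds.exists-68ee520c9a`, Wall 1964, Lemma 2,
`WallBoundingHandlebody.lean`; the splicing step of item 6 of the route recorded there).
Everything here is **proved**; no named facts.

The situation: on the cobordism `K = W − D̊⁵` the handle rearrangements of Milnor's §§4–8
produce a Morse function `g` of the triad (`WallHandlebodyProgram.lean`) which near the incoming
end `V = ∂D⁵` has nothing to do with the restriction `u` of the Morse function of `W` that cut `K`
out (`RegularSlab.fn`).  To realise the handlebody `D⁵ ∪ {g ≤ m}` as a sublevel set of ONE smooth
Morse function on `W` we blend: **`φ = (1 − χ(g)) · u + χ(g) · A g`** with a smooth step `χ`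
vanishing for `g ≤ ε/3` and equal to `1` for `g ≥ 2ε/3` (`Real.smoothTransition`), `A = 3/ε`.

* `Cobordism.IsMorseFunction.mlineDeriv_pos_of_apply_eq_zero` — **on `V` every gradient-like
  vector field `ξ` of `u` is transverse for `g` too, `ξ(g) > 0`**: both `u` and `g` are `≥ 0`
  with `u = g = 0` exactly on `V` and nonzero differentials there (Milnor 1965, Def. 3.1), so
  their differentials at a point of `V` are positive multiples of the inward conormal
  (`mfderiv_pos_iff_of_isLocalMin`, `BoundaryLocalMinDerivative.lean`).
* `Cobordism.IsMorseFunction.exists_level_mlineDeriv_pos` — by continuity and compactness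
  `ξ(g) > 0` and `ξ(u) > 0` on a whole collar `{g ≤ ε}`, `0 < ε < 1` (which therefore contains
  no critical point of `g` or `u`).
* `mlineDeriv_blend` — the derivative of the blend along a vector:
  `dφ(v) = (1 − χ(g)) du(v) + (χ(g) A + χ'(g)(A g − u)) dg(v)`.
* `Cobordism.IsMorseFunction.exists_blend` — **the blend**: a smooth `φ : K → ℝ` with `φ = u`
  on `{g ≤ ε/3}`, `φ = (3/ε) g` on `{2ε/3 ≤ g}`, no critical points in `{g ≤ ε}` (there
  `dφ(ξ) > 0`: all coefficients are `≥ 0` since `χ' ≥ 0` and `A g − u ≥ 1 − u ≥ 0` where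
  `χ' ≠ 0`), the critical points of `φ` are exactly those of `g`, near each of which
  `φ = (3/ε) g`, so `φ` is a Morse function with the same indices (Milnor 1965, Thm. 4.8,
  alternate version: renormalisation does not change indices; `MorseAffine.lean`).

This is the analytic content of Milnor's remark that Morse functions of composable triads can be
pieced together smoothly across the common boundary (1965, proof of Thm. 1.4 / Lemma 3.7 via
collars), in the special case — sufficient here — where both pieces already live in one ambient
manifold.

## References

* C. T. C. Wall, *On simply-connected 4-manifolds*, J. London Math. Soc. 39 (1964), proof of
  Lemma 2 (p. 144: "`H` be `D⁵` together with a neighbourhood of the images of the `fᵢ` …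
  which can be chosen to be a smooth submanifold of `W`"). [WallJLMS1964]
* J. Milnor, *Lectures on the h-cobordism theorem* (1965), Def. 3.1, Lemma 3.2, Thm. 4.8
  (alternate version). [MilnorHCobordism1965]
* J. M. Lee, *Introduction to Smooth Manifolds*, 2nd ed. (2013), Prop. 5.41. [LeeSmoothManifolds2013]
-/

open scoped Manifold ContDiff Topology
open Set Function Filter

noncomputable section

universe u

namespace Literature.Topology.FourManifolds

/-- Local notation: `𝔼 n` is the model Euclidean space `EuclideanSpace ℝ (Fin n)`. -/
local notation "𝔼 " n:arg => EuclideanSpace ℝ (Fin n)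

/-! ### The derivative of the blend along a vector -/

section Calculus

variable {E : Type*} [NormedAddCommGroup E] [NormedSpace ℝ E] {H : Type*} [TopologicalSpace H]
  {I : ModelWithCorners ℝ E H} {M : Type*} [TopologicalSpace M] [ChartedSpace H M]

/-- **The derivative of the blend `φ = u + χ(g) · (A g − u)` along a vector**:
`dφ(v) = (1 − χ(g)) du(v) + (χ(g) A + χ'(g) (A g − u)) dg(v)` (Leibniz and chain rules, in
the extended chart at `x`). [folklore] -/
theorem mlineDeriv_blend {u g : M → ℝ} {x : M} (hu : MDifferentiableAt I 𝓘(ℝ, ℝ) u x)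
    (hg : MDifferentiableAt I 𝓘(ℝ, ℝ) g x) {χ : ℝ → ℝ} {c : ℝ} (hχ : HasDerivAt χ c (g x)) (A : ℝ)
    (hφ : MDifferentiableAt I 𝓘(ℝ, ℝ) (fun y => u y + χ (g y) * (A * g y - u y)) x) (v : E) :
    mlineDeriv I (fun y => u y + χ (g y) * (A * g y - u y)) x v =
      (1 - χ (g x)) * mlineDeriv I u x v + (χ (g x) * A + c * (A * g x - u x)) * mlineDeriv I g x v := by
  unfold mlineDeriv
  rw [hφ.mfderiv, hu.mfderiv, hg.mfderiv]
  have hUd : HasFDerivWithinAt (writtenInExtChartAt I 𝓘(ℝ, ℝ) x u)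
      (fderivWithin ℝ (writtenInExtChartAt I 𝓘(ℝ, ℝ) x u) (range I) (extChartAt I x x)) (range I)
      (extChartAt I x x) :=
    hu.differentiableWithinAt_writtenInExtChartAt.hasFDerivWithinAt
  have hGd : HasFDerivWithinAt (writtenInExtChartAt I 𝓘(ℝ, ℝ) x g)
      (fderivWithin ℝ (writtenInExtChartAt I 𝓘(ℝ, ℝ) x g) (range I) (extChartAt I x x)) (range I)
      (extChartAt I x x) :=
    hg.differentiableWithinAt_writtenInExtChartAt.hasFDerivWithinAt
  set x₀ := extChartAt I x x with hx₀
  set U := writtenInExtChartAt I 𝓘(ℝ, ℝ) x u with hU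
  set G := writtenInExtChartAt I 𝓘(ℝ, ℝ) x g with hG
  have hUx : U x₀ = u x := by simp [hU, hx₀, writtenInExtChartAt]
  have hGx : G x₀ = g x := by simp [hG, hx₀, writtenInExtChartAt]
  have hxs : UniqueDiffWithinAt ℝ (range I) x₀ :=
    I.uniqueDiffOn _ (extChartAt_target_subset_range x (mem_extChartAt_target x))
  have hχ' : HasDerivAt χ c (G x₀) := by rw [hGx]; exact hχ
  have hχG := hχ'.comp_hasFDerivWithinAt x₀ hGd
  have hAG := hGd.const_mul A
  have hQ := hAG.sub hUd
  have hPQ := hχG.mul hQ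
  have hΦ := hUd.add hPQ
  -- the written blend is the blend of the written functions
  have hw : writtenInExtChartAt I 𝓘(ℝ, ℝ) x (fun y => u y + χ (g y) * (A * g y - u y)) =
      U + χ ∘ G * ((fun y => A * G y) - U) := by
    funext y; simp [hU, hG, writtenInExtChartAt]
  rw [hw]
  have key : (fderivWithin ℝ (U + χ ∘ G * ((fun y => A * G y) - U)) (range I) x₀ : E →L[ℝ] ℝ) v =
      (1 - χ (g x)) * (fderivWithin ℝ U (range I) x₀ : E →L[ℝ] ℝ) v +
        (χ (g x) * A + c * (A * g x - u x)) * (fderivWithin ℝ G (range I) x₀ : E →L[ℝ] ℝ) v := by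
    rw [hΦ.fderivWithin hxs]
    simp only [add_apply, sub_apply, FunLike.coe_smul, Pi.smul_apply, Pi.sub_apply, smul_eq_mul,
      Function.comp_apply, hUx, hGx]
    ring
  exact key

end Calculus

/-! ### The smooth step -/

section Step

/-- The smooth step `χ_ε(t) = smoothTransition (3t/ε − 1)`: `0` for `t ≤ ε/3`, `1` for
`t ≥ 2ε/3`, monotone, smooth. [folklore] -/
def blendStep (ε : ℝ) (t : ℝ) : ℝ := Real.smoothTransition (3 * t / ε - 1)

variable {ε : ℝ}

/-- `χ_ε = 0` on `t ≤ ε/3`. [folklore] -/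
theorem blendStep_of_le (hε : 0 < ε) {t : ℝ} (ht : t ≤ ε / 3) : blendStep ε t = 0 :=
  Real.smoothTransition.zero_of_nonpos (by
    rw [sub_nonpos, div_le_one hε]; linarith)

/-- `χ_ε = 1` on `2ε/3 ≤ t`. [folklore] -/
theorem blendStep_of_ge (hε : 0 < ε) {t : ℝ} (ht : 2 * ε / 3 ≤ t) : blendStep ε t = 1 :=
  Real.smoothTransition.one_of_one_le (by
    rw [le_sub_iff_add_le, le_div_iff₀ hε]; linarith)

/-- `0 ≤ χ_ε ≤ 1`. [folklore] -/
theorem blendStep_mem_Icc (ε t : ℝ) : blendStep ε t ∈ Icc (0 : ℝ) 1 :=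
  ⟨Real.smoothTransition.nonneg _, Real.smoothTransition.le_one _⟩

/-- `χ_ε` is smooth. [folklore] -/
theorem contDiff_blendStep (ε : ℝ) : ContDiff ℝ ∞ (blendStep ε) :=
  Real.smoothTransition.contDiff.comp
    (((contDiff_const.mul contDiff_id).div_const ε).sub contDiff_const)

/-- `χ_ε` is monotone (`ε > 0`). [folklore] -/
theorem monotone_blendStep (hε : 0 < ε) : Monotone (blendStep ε) := fun s t hst =>
  Real.smoothTransition.monotone (by
    rw [sub_le_sub_iff_right]; exact div_le_div_of_nonneg_right (by linarith) hε.le)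

/-- `χ_ε` has a nonnegative derivative everywhere, vanishing on `t < ε/3`. [folklore] -/
theorem hasDerivAt_blendStep (hε : 0 < ε) (t : ℝ) :
    ∃ c : ℝ, HasDerivAt (blendStep ε) c t ∧ 0 ≤ c ∧ (t < ε / 3 → c = 0) := by
  have hd : DifferentiableAt ℝ (blendStep ε) t :=
    ((contDiff_blendStep ε).differentiable (by simp)).differentiableAt
  refine ⟨deriv (blendStep ε) t, hd.hasDerivAt, (monotone_blendStep hε).deriv_nonneg, fun ht => ?_⟩
  have hloc : blendStep ε =ᶠ[𝓝 t] fun _ => (0 : ℝ) := by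
    filter_upwards [Iio_mem_nhds ht] with s hs
    exact blendStep_of_le hε hs.le
  rw [hloc.deriv_eq, deriv_const]

end Step

/-! ### On the incoming end a gradient-like field of one Morse function is transverse for
every other -/

section Collar

variable {n : ℕ} {V P : Type u} [TopologicalSpace V] [T2Space V] [SecondCountableTopology V]
  [ChartedSpace (𝔼 n) V] [IsManifold (𝓡 n) ∞ V] [CompactSpace V]
  [TopologicalSpace P] [T2Space P] [SecondCountableTopology P] [ChartedSpace (𝔼 n) P]
  [IsManifold (𝓡 n) ∞ P] [CompactSpace P] {d : Cobordism n V P} {u g : d.W → ℝ}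

omit [T2Space V] [SecondCountableTopology V] [IsManifold (𝓡 n) ∞ V] [CompactSpace V] [T2Space P]
  [SecondCountableTopology P] [IsManifold (𝓡 n) ∞ P] [CompactSpace P] in
/-- **On the incoming boundary, `ξ(g) > 0` for a gradient-like field `ξ` of `u`** (both Morse
functions of the triad vanish exactly on `V = u⁻¹(0) = g⁻¹(0)`, are `≥ 0`, and have nonzero
differentials on `V`, Milnor 1965, Def. 3.1; so `duₚ`, `dgₚ` are positive multiples of the inward
conormal, `BoundaryLocalMinDerivative.lean`). [cite: MilnorHCobordism1965, Def. 3.1 (PDF p. 11)] [cite: LeeSmoothManifolds2013, Prop. 5.41] -/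
theorem Cobordism.IsMorseFunction.mlineDeriv_pos_of_apply_eq_zero (hu : d.IsMorseFunction u)
    (hg : d.IsMorseFunction g) {ξ : Π x : d.W, TangentSpace (𝓡∂ (n + 1)) x}
    (hξ : IsGradientLike (𝓡∂ (n + 1)) u ξ) {p : d.W} (hp : u p = 0) :
    0 < mlineDeriv (𝓡∂ (n + 1)) g p (ξ p) := by
  have hpV : p ∈ range d.inl := by rw [← hu.preimage_zero]; exact hp
  have hgp : g p = 0 := by
    have : p ∈ g ⁻¹' {0} := by rw [hg.preimage_zero]; exact hpV
    exact this
  have hud : MDifferentiableAt (𝓡∂ (n + 1)) 𝓘(ℝ, ℝ) u p := hu.isMorse.contMDiff.mdifferentiableAt (by simp)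
  have hgd : MDifferentiableAt (𝓡∂ (n + 1)) 𝓘(ℝ, ℝ) g p := hg.isMorse.contMDiff.mdifferentiableAt (by simp)
  have hminu : ∀ᶠ q in 𝓝 p, u p ≤ u q := Eventually.of_forall fun q => by rw [hp]; exact (hu.mem_Icc q).1
  have hming : ∀ᶠ q in 𝓝 p, g p ≤ g q := Eventually.of_forall fun q => by rw [hgp]; exact (hg.mem_Icc q).1
  have hucrit : ¬ IsMCriticalPt (𝓡∂ (n + 1)) u p := fun h =>
    (hu.apply_mem_Ioo_of_mem_criticalSet h).1.ne' hp
  have hgcrit : ¬ IsMCriticalPt (𝓡∂ (n + 1)) g p := fun h =>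
    (hg.apply_mem_Ioo_of_mem_criticalSet h).1.ne' hgp
  exact (mfderiv_pos_iff_of_isLocalMin hud hgd hminu hming hucrit hgcrit (ξ p)).1
    (hξ.mlineDeriv_pos p hucrit)

omit [T2Space V] [SecondCountableTopology V] [IsManifold (𝓡 n) ∞ V] [CompactSpace V] [T2Space P]
  [SecondCountableTopology P] [IsManifold (𝓡 n) ∞ P] [CompactSpace P] in
/-- **A collar `{g ≤ ε}` on which `ξ(g) > 0` and `ξ(u) > 0`** (`0 < ε < 1`): the set where both
hold is open (the pairings are smooth, `contMDiff_mlineDeriv_section`) and contains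
`g⁻¹(0) = V`; its complement is compact and `g > 0` on it. [cite: MilnorHCobordism1965, Def. 3.1 and proof of Thm. 3.4] -/
theorem Cobordism.IsMorseFunction.exists_level_mlineDeriv_pos (hu : d.IsMorseFunction u)
    (hg : d.IsMorseFunction g)
    (ξ : Cₛ^∞⟮𝓡∂ (n + 1); 𝔼 (n + 1), (TangentSpace (𝓡∂ (n + 1)) : d.W → Type)⟯)
    (hξ : IsGradientLike (𝓡∂ (n + 1)) u ξ) :
    ∃ ε : ℝ, 0 < ε ∧ ε < 1 ∧ ∀ p, g p ≤ ε →
      0 < mlineDeriv (𝓡∂ (n + 1)) g p (ξ p) ∧ 0 < mlineDeriv (𝓡∂ (n + 1)) u p (ξ p) := by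
  set G : Set d.W := {p | 0 < mlineDeriv (𝓡∂ (n + 1)) g p (ξ p) ∧ 0 < mlineDeriv (𝓡∂ (n + 1)) u p (ξ p)}
    with hG
  have hcg : Continuous fun p => mlineDeriv (𝓡∂ (n + 1)) g p (ξ p) :=
    (contMDiff_mlineDeriv_section hg.isMorse.contMDiff ξ.contMDiff).continuous
  have hcu : Continuous fun p => mlineDeriv (𝓡∂ (n + 1)) u p (ξ p) :=
    (contMDiff_mlineDeriv_section hu.isMorse.contMDiff ξ.contMDiff).continuous
  have hGo : IsOpen G := (isOpen_lt continuous_const hcg).inter (isOpen_lt continuous_const hcu)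
  have hVG : ∀ p, g p = 0 → p ∈ G := by
    intro p hp
    have hpV : p ∈ range d.inl := by rw [← hg.preimage_zero]; exact hp
    have hup : u p = 0 := by
      have : p ∈ u ⁻¹' {0} := by rw [hu.preimage_zero]; exact hpV
      exact this
    have hucrit : ¬ IsMCriticalPt (𝓡∂ (n + 1)) u p := fun h =>
      (hu.apply_mem_Ioo_of_mem_criticalSet h).1.ne' hup
    exact ⟨hu.mlineDeriv_pos_of_apply_eq_zero hg hξ hup, hξ.mlineDeriv_pos p hucrit⟩
  -- the complement is compact and `g > 0` on it
  have hKc : IsCompact Gᶜ := hGo.isClosed_compl.isCompact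
  by_cases hne : (Gᶜ).Nonempty
  · obtain ⟨q, hq, hqmin⟩ := hKc.exists_isMinOn hne hg.isMorse.contMDiff.continuous.continuousOn
    have hgq : 0 < g q := lt_of_le_of_ne (hg.mem_Icc q).1 fun h => hq (hVG q h.symm)
    refine ⟨min (g q / 2) (1 / 2), lt_min (by linarith) (by norm_num),
      (min_le_right _ _).trans_lt (by norm_num), fun p hp => ?_⟩
    by_contra hpG
    have hpG' : p ∈ Gᶜ := hpG
    have := hqmin hpG'
    simp only [mem_setOf_eq] at this
    linarith [min_le_left (g q / 2) (1 / 2)]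
  · refine ⟨1 / 2, by norm_num, by norm_num, fun p _ => ?_⟩
    by_contra hpG
    exact hne ⟨p, hpG⟩

end Collar

/-! ### The blend -/

section Blend

variable {n : ℕ} {V P : Type u} [TopologicalSpace V] [T2Space V] [SecondCountableTopology V]
  [ChartedSpace (𝔼 n) V] [IsManifold (𝓡 n) ∞ V] [CompactSpace V]
  [TopologicalSpace P] [T2Space P] [SecondCountableTopology P] [ChartedSpace (𝔼 n) P]
  [IsManifold (𝓡 n) ∞ P] [CompactSpace P] {d : Cobordism n V P} {u g : d.W → ℝ}

omit [T2Space V] [SecondCountableTopology V] [IsManifold (𝓡 n) ∞ V] [CompactSpace V] [T2Space P]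
  [SecondCountableTopology P] [IsManifold (𝓡 n) ∞ P] [CompactSpace P] in
/-- **The blend of two Morse functions of a triad near the incoming end** (the module docstring
displays the argument).  For Morse functions `u`, `g` of the triad `(K; V, P)` (Milnor 1965,
Def. 3.1) and `m₀ > 0` there are `ε ∈ (0, 1)`, `ε < m₀`, and a smooth `φ : K → ℝ` such that:
`φ = u` on `{g ≤ ε/3}`; `φ = (3/ε) · g` on `{2ε/3 ≤ g}`; `φ` has no critical point in `{g ≤ ε}`
and every critical point of `g` has `g > ε`; the critical points of `φ` are exactly those of
`g`, with `φ = (3/ε) · g` near each of them (so the same indices); `φ` is a Morse function;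
`0 ≤ φ ≤ max(u, (3/ε) g)`, and `φ = 0` exactly where `u = 0`. [cite: MilnorHCobordism1965, Def. 3.1, Lemma 3.2 and Thm. 4.8 (alternate version)] [cite: WallJLMS1964, proof of Lemma 2 (p. 144)] -/
theorem Cobordism.IsMorseFunction.exists_blend (hu : d.IsMorseFunction u) (hg : d.IsMorseFunction g)
    {m₀ : ℝ} (hm₀ : 0 < m₀) :
    ∃ (ε : ℝ) (φ : d.W → ℝ), 0 < ε ∧ ε < 1 ∧ ε < m₀ ∧ ContMDiff (𝓡∂ (n + 1)) 𝓘(ℝ, ℝ) ∞ φ ∧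
      (∀ p, g p ≤ ε / 3 → φ p = u p) ∧
      (∀ p, 2 * ε / 3 ≤ g p → φ p = 3 / ε * g p) ∧
      (∀ p, g p ≤ ε → ¬ IsMCriticalPt (𝓡∂ (n + 1)) φ p) ∧
      (∀ p ∈ criticalSet (𝓡∂ (n + 1)) g, ε < g p) ∧
      (∀ p ∈ criticalSet (𝓡∂ (n + 1)) u, ε < g p) ∧
      criticalSet (𝓡∂ (n + 1)) φ = criticalSet (𝓡∂ (n + 1)) g ∧
      (∀ p ∈ criticalSet (𝓡∂ (n + 1)) g, φ =ᶠ[𝓝 p] fun q => 3 / ε * g q + 0) ∧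
      (∀ p ∈ criticalSet (𝓡∂ (n + 1)) g,
        morseIndex (𝓡∂ (n + 1)) φ p = morseIndex (𝓡∂ (n + 1)) g p) ∧
      IsMorse (𝓡∂ (n + 1)) φ ∧
      (∀ p, 0 ≤ φ p) ∧ (∀ p, φ p = 0 ↔ u p = 0) ∧ (∀ p, φ p ≤ max (u p) (3 / ε * g p)) := by
  obtain ⟨ξ, hξ⟩ := Cobordism.Milnor1965_exists_isGradientLike_holds (c := d) hu
  obtain ⟨ε₁, hε0₁, hε1₁, hpos₁⟩ := hu.exists_level_mlineDeriv_pos hg ξ hξ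
  set ε : ℝ := min ε₁ (m₀ / 2) with hεd
  have hε0 : 0 < ε := lt_min hε0₁ (by linarith)
  have hε1 : ε < 1 := (min_le_left _ _).trans_lt hε1₁
  have hεm : ε < m₀ := (min_le_right _ _).trans_lt (by linarith)
  have hpos : ∀ p, g p ≤ ε →
      0 < mlineDeriv (𝓡∂ (n + 1)) g p (ξ p) ∧ 0 < mlineDeriv (𝓡∂ (n + 1)) u p (ξ p) :=
    fun p hp => hpos₁ p (hp.trans (min_le_left _ _))
  set A : ℝ := 3 / ε with hA
  have hA0 : 0 < A := by positivity
  have hAε : A * (ε / 3) = 1 := by rw [hA]; field_simp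
  set φ : d.W → ℝ := fun y => u y + blendStep ε (g y) * (A * g y - u y) with hφd
  have hus : ContMDiff (𝓡∂ (n + 1)) 𝓘(ℝ, ℝ) ∞ u := hu.isMorse.contMDiff
  have hgs : ContMDiff (𝓡∂ (n + 1)) 𝓘(ℝ, ℝ) ∞ g := hg.isMorse.contMDiff
  have hgd : MDifferentiable (𝓡∂ (n + 1)) 𝓘(ℝ, ℝ) g := hgs.mdifferentiable (by simp)
  have hud : MDifferentiable (𝓡∂ (n + 1)) 𝓘(ℝ, ℝ) u := hus.mdifferentiable (by simp)
  have hφs : ContMDiff (𝓡∂ (n + 1)) 𝓘(ℝ, ℝ) ∞ φ := by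
    have h1 : ContMDiff (𝓡∂ (n + 1)) 𝓘(ℝ, ℝ) ∞ fun y => blendStep ε (g y) :=
      (contDiff_blendStep ε).comp_contMDiff hgs
    have h2 : ContMDiff (𝓡∂ (n + 1)) 𝓘(ℝ, ℝ) ∞ fun y => A * g y - u y :=
      ((contDiff_const.mul contDiff_id).comp_contMDiff hgs).sub hus
    exact hus.add (h1.mul h2)
  -- values
  have hlow : ∀ p, g p ≤ ε / 3 → φ p = u p := fun p hp => by
    simp only [hφd, blendStep_of_le hε0 hp, zero_mul, add_zero]
  have hhigh : ∀ p, 2 * ε / 3 ≤ g p → φ p = A * g p := fun p hp => by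
    simp only [hφd, blendStep_of_ge hε0 hp, one_mul]; ring
  -- critical points of `g` and `u` lie above `ε`
  have hcritg : ∀ p ∈ criticalSet (𝓡∂ (n + 1)) g, ε < g p := by
    intro p hp
    by_contra hle
    have h := (hpos p (not_lt.1 hle)).1
    have h0 : mlineDeriv (𝓡∂ (n + 1)) g p (ξ p) = 0 := by
      unfold mlineDeriv; rw [show mfderiv (𝓡∂ (n + 1)) 𝓘(ℝ, ℝ) g p = 0 from hp]; rfl
    linarith
  have hcritu : ∀ p ∈ criticalSet (𝓡∂ (n + 1)) u, ε < g p := by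
    intro p hp
    by_contra hle
    have h := (hpos p (not_lt.1 hle)).2
    have h0 : mlineDeriv (𝓡∂ (n + 1)) u p (ξ p) = 0 := by
      unfold mlineDeriv; rw [show mfderiv (𝓡∂ (n + 1)) 𝓘(ℝ, ℝ) u p = 0 from hp]; rfl
    linarith
  -- no critical point of `φ` in the collar: `dφ(ξ) > 0` there
  have hnocrit : ∀ p, g p ≤ ε → ¬ IsMCriticalPt (𝓡∂ (n + 1)) φ p := by
    intro p hp hc
    obtain ⟨c, hc', hc0, hcz⟩ := hasDerivAt_blendStep hε0 (g p)
    have hder := mlineDeriv_blend (hud p) (hgd p) hc' A (hφs.mdifferentiableAt (by simp)) (ξ p)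
    have hzero : mlineDeriv (𝓡∂ (n + 1)) φ p (ξ p) = 0 := by
      unfold mlineDeriv; rw [show mfderiv (𝓡∂ (n + 1)) 𝓘(ℝ, ℝ) φ p = 0 from hc]; rfl
    obtain ⟨hgξ, huξ⟩ := hpos p hp
    have hχI := blendStep_mem_Icc ε (g p)
    -- the coefficient `c · (A g − u)` is nonnegative
    have hcoef : 0 ≤ c * (A * g p - u p) := by
      by_cases hlt : g p < ε / 3
      · rw [hcz hlt, zero_mul]
      · refine mul_nonneg hc0 ?_
        have h1 : A * (ε / 3) ≤ A * g p := mul_le_mul_of_nonneg_left (not_lt.1 hlt) hA0.le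
        have h2 : u p ≤ 1 := (hu.mem_Icc p).2
        linarith
    have key : 0 < (1 - blendStep ε (g p)) * mlineDeriv (𝓡∂ (n + 1)) u p (ξ p) +
        (blendStep ε (g p) * A + c * (A * g p - u p)) * mlineDeriv (𝓡∂ (n + 1)) g p (ξ p) := by
      rcases eq_or_lt_of_le hχI.2 with h1 | h1
      · rw [h1, sub_self, zero_mul, zero_add, one_mul]
        exact mul_pos (by nlinarith) hgξ
      · have : 0 < (1 - blendStep ε (g p)) * mlineDeriv (𝓡∂ (n + 1)) u p (ξ p) := mul_pos (by linarith) huξ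
        nlinarith [hχI.1, mul_nonneg (mul_nonneg hχI.1 hA0.le) hgξ.le, mul_nonneg hcoef hgξ.le]
    rw [← hder] at key
    change 0 < mlineDeriv (𝓡∂ (n + 1)) φ p (ξ p) at key
    linarith
  -- near a point with `g > 2ε/3` the blend is `A g`
  have hev : ∀ p, 2 * ε / 3 < g p → φ =ᶠ[𝓝 p] fun q => A * g q + 0 := by
    intro p hp
    have ho : IsOpen {q : d.W | 2 * ε / 3 < g q} := isOpen_lt continuous_const hgs.continuous
    filter_upwards [ho.mem_nhds hp] with q hq
    rw [hhigh q hq.le, add_zero]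
  have hcriteq : criticalSet (𝓡∂ (n + 1)) φ = criticalSet (𝓡∂ (n + 1)) g := by
    ext p
    constructor
    · intro hp
      have hgp : ε < g p := by
        by_contra hle
        exact hnocrit p (not_lt.1 hle) hp
      have h := (isMCriticalPt_congr_of_eventuallyEq (I := 𝓡∂ (n + 1)) (hev p (by linarith))).1 hp
      exact (isMCriticalPt_const_mul_add_iff hA0.ne' 0 (hgd p)).1 h
    · intro hp
      have hgp := hcritg p hp
      exact (isMCriticalPt_congr_of_eventuallyEq (I := 𝓡∂ (n + 1)) (hev p (by linarith))).2
        ((isMCriticalPt_const_mul_add_iff hA0.ne' 0 (hgd p)).2 hp)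
  have hind : ∀ p ∈ criticalSet (𝓡∂ (n + 1)) g,
      morseIndex (𝓡∂ (n + 1)) φ p = morseIndex (𝓡∂ (n + 1)) g p := by
    intro p hp
    rw [morseIndex_congr_of_eventuallyEq (I := 𝓡∂ (n + 1)) (hev p (by linarith [hcritg p hp])),
      morseIndex_const_mul_add g hA0 0 p]
  have hmorse : IsMorse (𝓡∂ (n + 1)) φ := by
    refine ⟨hφs, fun p hp => ?_⟩
    have hpg : p ∈ criticalSet (𝓡∂ (n + 1)) g := by rw [← hcriteq]; exact hp
    have hAg := hg.isMorse.const_mul_add hA0.ne' 0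
    have hev' : φ =ᶠ[𝓝 p] fun y => (A * g y + 0) + 0 :=
      (hev p (by linarith [hcritg p hpg])).trans
        (Filter.Eventually.of_forall fun y => (by ring : A * g y + 0 = A * g y + 0 + 0))
    rw [mhessian_congr_of_eventuallyEq_add_const (I := 𝓡∂ (n + 1)) (c := 0) hev']
    exact hAg.nondegenerate ((isMCriticalPt_const_mul_add_iff hA0.ne' 0 (hgd p)).2 hpg)
  -- nonnegativity and the zero set
  have hnonneg : ∀ p, 0 ≤ φ p := by
    intro p
    have hχI := blendStep_mem_Icc ε (g p)
    have hu0 := (hu.mem_Icc p).1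
    have hg0 := (hg.mem_Icc p).1
    show 0 ≤ u p + blendStep ε (g p) * (A * g p - u p)
    have : u p + blendStep ε (g p) * (A * g p - u p) = (1 - blendStep ε (g p)) * u p + blendStep ε (g p) * (A * g p) := by ring
    rw [this]
    exact add_nonneg (mul_nonneg (by linarith [hχI.2]) hu0)
      (mul_nonneg hχI.1 (mul_nonneg hA0.le hg0))
  have hzero : ∀ p, φ p = 0 ↔ u p = 0 := by
    intro p
    have hχI := blendStep_mem_Icc ε (g p)
    have hu0 := (hu.mem_Icc p).1
    have hg0 := (hg.mem_Icc p).1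
    have hug : u p = 0 ↔ g p = 0 := by
      rw [← mem_singleton_iff, ← mem_preimage, hu.preimage_zero, ← hg.preimage_zero]; rfl
    constructor
    · intro h
      have h' : (1 - blendStep ε (g p)) * u p + blendStep ε (g p) * (A * g p) = 0 := by
        have : u p + blendStep ε (g p) * (A * g p - u p) = (1 - blendStep ε (g p)) * u p + blendStep ε (g p) * (A * g p) := by ring
        rw [← this]; exact h
      have h1 : 0 ≤ (1 - blendStep ε (g p)) * u p := mul_nonneg (by linarith [hχI.2]) hu0
      have h2 : 0 ≤ blendStep ε (g p) * (A * g p) := mul_nonneg hχI.1 (mul_nonneg hA0.le hg0)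
      have h1' : (1 - blendStep ε (g p)) * u p = 0 := by linarith
      have h2' : blendStep ε (g p) * (A * g p) = 0 := by linarith
      rcases mul_eq_zero.1 h1' with h3 | h3
      · -- `χ = 1`, so `g ≥ 2ε/3 > 0`... then `A g = 0` forces `g = 0`: contradiction unless `u = 0`
        have hχ1 : blendStep ε (g p) = 1 := by linarith
        rw [hχ1, one_mul] at h2'
        have : g p = 0 := by
          rcases mul_eq_zero.1 h2' with h4 | h4
          · exact absurd h4 hA0.ne'
          · exact h4
        exact hug.2 this
      · exact h3
    · intro h
      have hg' : g p = 0 := hug.1 h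
      show u p + blendStep ε (g p) * (A * g p - u p) = 0
      rw [h, hg']; simp
  have hle : ∀ p, φ p ≤ max (u p) (A * g p) := by
    intro p
    have hχI := blendStep_mem_Icc ε (g p)
    show u p + blendStep ε (g p) * (A * g p - u p) ≤ max (u p) (A * g p)
    have : u p + blendStep ε (g p) * (A * g p - u p) =
        (1 - blendStep ε (g p)) * u p + blendStep ε (g p) * (A * g p) := by ring
    rw [this]
    have h1 : (1 - blendStep ε (g p)) * u p ≤ (1 - blendStep ε (g p)) * max (u p) (A * g p) :=
      mul_le_mul_of_nonneg_left (le_max_left _ _) (by linarith [hχI.2])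
    have h2 : blendStep ε (g p) * (A * g p) ≤ blendStep ε (g p) * max (u p) (A * g p) :=
      mul_le_mul_of_nonneg_left (le_max_right _ _) hχI.1
    nlinarith
  refine ⟨ε, φ, hε0, hε1, hεm, hφs, hlow, fun p hp => hhigh p hp, hnocrit, hcritg, hcritu, hcriteq,
    fun p hp => hev p (by linarith [hcritg p hp]), hind, hmorse, hnonneg, hzero, hle⟩

end Blend

end Literature.Topology.FourManifolds
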